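import Literature.AnabelianGeometry.AbsoluteAnabelian.AbsTopIII.FrobeniusPictureMLFCores

/-!
# [AbsTopIII] Corollary 3.6 (ii): the coherence of `η_⋎` with `η_An` is NECESSARY

S. Mochizuki, *Topics in Absolute Anabelian Geometry III*, Cor. 3.6 (ii) pp. 79–80 (manuscript
`paper:url-5493eb38cbb7`; bib key `MochizukiAbsTopIII2015`): the contact structure `ℋ_An` is
generated by `η_{□⋎}`, "the identity natural transformation from the arrow `φ_□ : Anab → 𝒳` to the
composite arrow `id_⋎ ∘ φ_⋎ : Anab → 𝒳`", and the `η_⋏`, "the isomorphism arising from `η_An`", and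
it is a contact structure, i.e. compatible with the telecore family `𝒥` (Def. 3.5 (iv)).  In the
typed statement `LogFrobeniusData.TelecoreStmt τ` (seat abc-iut-L4-t5) the first-row generator
`η_⋎` is the datum `τ.η₁`; `FrobeniusPictureMLFTelecoreProofs.lean` proves `TelecoreStmt τ` under
the coherence hypothesis `id_⋎ (η_⋎)_x = e_{π_An(id_⋎ x)} ∘ (η_An)_{id_⋎ x}`.  This file proves the
CONVERSE on the essential image of `φ_⋎` (`coherent_of_telecoreStmt`): any telecore `𝔗_An` with a
compatible contact structure whose homotopies on the generators are the printed ones forces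
`id_⋎ (η_⋎)_{φ_⋎ a} = e_{π_An(id_⋎ φ_⋎ a)} ∘ (η_An)_{id_⋎ φ_⋎ a}`.  Proof: the pair
`([β¹_⋎]∘[φ_⋎], [φ_⋎])` is both a whiskered contact generator and a telecore pair
`([φ_⋎]∘[γ₁], [φ_⋎]∘[γ₂])` (likewise for `□`, and for `([σ]∘[φ_□], [σ]∘[id_⋎]∘[φ_⋎])`); comparing
the two evaluations of the common family and composing the core homotopies around the loops
`Anab → □ → 𝒩 → ℰ → Anab`, `Anab → ⋎ → □ → 𝒩 → ℰ → Anab` gives the identity.  So the hypothesis of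
`telecoreStmt_of_coherent` is not idle.  Nothing here takes a side on inter-universal Teichmüller
theory.
-/

namespace Literature.AnabelianGeometry.AbsoluteAnabelian

open _root_.CategoryTheory _root_.Quiver

universe u

namespace LogFrobeniusData

open DiagramOfCategories

variable (Δ : LogFrobeniusData.{u}) (τ : Δ.TelecoreData)

/-! ### Paths through the core vertex -/

/-- `□` is a vertex of `𝒟_{≤4}`. [cite: MochizukiAbsTopIII2015, Corollary 3.6 p.79] -/
theorem nexus_mem_le4 : LFVertex.nexus ∈ {a : LFVertex | a.row ≤ 4} := by simp [LFVertex.row]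

/-- `⋎` is a vertex of `𝒟_{≤4}`. [cite: MochizukiAbsTopIII2015, Corollary 3.6 p.79] -/
theorem row1_mem_le4 (n : ℤ) : LFVertex.row1 n ∈ {a : LFVertex | a.row ≤ 4} := by simp [LFVertex.row]

section Paths

variable (J : SubVertex {a : LFVertex | a.row ≤ 4} → Type u)

/-- `[κ_An] ∘ [𝒩 → ℰ] ∘ [λ^×] : □ → Anab` (the path that "descends [say, via `λ^×`] to the core
vertex"). [cite: MochizukiAbsTopIII2015, Corollary 3.6 (ii) p.79] -/
def pathToCore : Path (tvNexus J) (tvObs J) :=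
  (((Path.nil : Path (tvNexus J) (tvNexus J)).cons
    (show tvNexus J ⟶ tvThird J from LFVertex.lamTimesEdge)).cons
    (show tvThird J ⟶ tvFourth J from LFVertex.edge34)).cons
    (show tvFourth J ⟶ tvObs J from (PUnit.unit : coreI5.{u} (vx 4 .fourth (by decide))))

variable {J}

/-- The loop `Anab —φ_□→ □ → 𝒩 → ℰ —κ_An→ Anab`. [cite: MochizukiAbsTopIII2015, Corollary 3.6 (ii) p.79] -/
def loopNexus (j : J (vx 4 .nexus (by decide))) : Path (tvObs J) (tvObs J) :=
  (pathPhiNexus j).comp (pathToCore J)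

/-- The loop `Anab —φ_⋎→ ⋎ —id_⋎→ □ → 𝒩 → ℰ —κ_An→ Anab` (`⋎ = 0`).
[cite: MochizukiAbsTopIII2015, Corollary 3.6 (ii) p.79] -/
def loopRow1 (jn : J (vx 4 (.row1 0) (by simp [LFVertex.row]))) : Path (tvObs J) (tvObs J) :=
  (pathPhiId 0 jn).comp (pathToCore J)

/-- The telecore edge `[φ_⋎] : Anab → ⋎` (`⋎ = 0`) as a path. [cite: MochizukiAbsTopIII2015, Corollary 3.6 (ii) p.79] -/
def edgeRow1 (jn : J (vx 4 (.row1 0) (by simp [LFVertex.row]))) : Path (tvObs J) (tvRow1 J 0) :=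
  (Path.nil : Path (tvObs J) (tvObs J)).cons (ePhi jn)

end Paths

/-! ### Bookkeeping helpers (heterogeneous equalities) -/

section Helpers

variable {A B : Type u} [Category.{u} A] [Category.{u} B]

/-- Components of heterogeneously equal natural transformations. [folklore] -/
private theorem app_heq_of_heq {F F' G G' : A ⥤ B} (hF : F = F') (hG : G = G') {α : F ⟶ G}
    {β : F' ⟶ G'} (h : α ≍ β) (a : A) : α.app a ≍ β.app a := by
  subst hF hG; cases h; rfl

/-- Components of a natural transformation at equal objects. [folklore] -/
private theorem app_heq {F G : A ⥤ B} (α : F ⟶ G) {y y' : A} (hy : y = y') :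
    α.app y ≍ α.app y' := by
  subst hy; rfl

/-- Equal functors send heterogeneously equal morphisms to heterogeneously equal morphisms. [folklore] -/
private theorem map_heq' {F G : A ⥤ B} (hFG : F = G) {x y x' y' : A} (hx : x = x') (hy : y = y')
    {f : x ⟶ y} {f' : x' ⟶ y'} (h : f ≍ f') : F.map f ≍ G.map f' := by
  subst hFG hx hy; cases h; rfl

/-- A functor equal to the identity, applied to an `eqToHom`-conjugate. [folklore] -/
private theorem map_conj_heq_of_eq_id {F : A ⥤ A} (hF : F = 𝟭 A) {x x' y y' : A} (p : x = x')
    (f : x' ⟶ y') (q : y' = y) : F.map (eqToHom p ≫ f ≫ eqToHom q) ≍ f := by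
  subst hF p q; simp

/-- A functor applied to an `eqToHom`-conjugate (heterogeneously). [folklore] -/
private theorem map_conj_heq (F : A ⥤ B) {x x' y y' : A} (p : x = x') (f : x' ⟶ y') (q : y' = y) :
    F.map (eqToHom p ≫ f ≫ eqToHom q) ≍ F.map f := by
  subst p q; simp

/-- Two `eqToHom`-conjugations of equal morphisms have heterogeneously equal cores. [folklore] -/
private theorem heq_of_conj_eq_conj {X Y X₁ Y₁ X₂ Y₂ : B} {f : X ⟶ Y} {g₁ : X₁ ⟶ Y₁} {g₂ : X₂ ⟶ Y₂}
    {p₁ : X = X₁} {q₁ : Y₁ = Y} {p₂ : X = X₂} {q₂ : Y₂ = Y}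
    (h₁ : f = eqToHom p₁ ≫ g₁ ≫ eqToHom q₁) (h₂ : f = eqToHom p₂ ≫ g₂ ≫ eqToHom q₂) : g₁ ≍ g₂ :=
  ((conj_eqToHom_iff_heq' _ _ p₁ q₁).1 h₁).symm.trans ((conj_eqToHom_iff_heq' _ _ p₂ q₂).1 h₂)

end Helpers

/-! ### An arbitrary telecore `𝔗_An` with a compatible contact structure -/

section Witness

variable {H : Δ.core5Diagram.HomotopyFamily}
  {hH : ∀ ⦃a b : coreShape5.{u}.Vertex⦄ ⦃p q : Path a b⦄, H.E p q → b = coreShape5.{u}.obs}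
  {hc : (Δ.coreObs5 H hH).IsCore} (T : (Δ.sub 4).Telecore (Δ.coreObs5 H hH) hc)
  (Hc K : (Δ.teleDiagram T.J T.telMap).HomotopyFamily)
  (hKc : ∀ ⦃a b : (teleShape T.J).Vertex⦄ ⦃p q : Path a b⦄ (h : Hc.E p q),
    ∃ h' : K.E p q, Hc.η h = K.η h')
  (hKj : ∀ ⦃a b : (teleShape T.J).Vertex⦄ ⦃p q : Path a b⦄ (h : T.Jfam.E p q),
    ∃ h' : K.E p q, T.Jfam.η h = K.η h')

/-- Objects along the loop through `□`: `κ_An((𝒳 → ℰ)(φ_An a))`. [folklore] -/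
private theorem loopNexus_obj (hT : Δ.IsTelecoreAn τ T) (j : T.J (vx 4 .nexus (by decide)))
    (a : Δ.A) : ((Δ.teleDiagram T.J T.telMap).pathFunctor (loopNexus j)).obj a =
      Δ.κ.obj (Δ.XtoE.obj (Δ.φ.obj a)) := by
  rw [loopNexus, pathFunctor_comp, Functor.comp_obj]
  erw [Δ.pathPhiNexus_obj T.J T.telMap j a, Functor.congr_obj (hT.telMap_nexus nexus_mem_le4 j) a]
  simp only [pathToCore, pathFunctor_cons, pathFunctor_nil]
  change Δ.κ.obj (Δ.NtoE.obj (Δ.lamTimes.obj (Δ.φ.obj a))) = _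
  rw [← Functor.comp_obj Δ.lamTimes Δ.NtoE, Δ.lamTimes_NtoE]

/-- Objects along the loop through `⋎`: `κ_An((𝒳 → ℰ)(id_⋎ (φ_⋎ a)))`. [folklore] -/
private theorem loopRow1_obj (hT : Δ.IsTelecoreAn τ T)
    (jn : T.J (vx 4 (.row1 0) (by simp [LFVertex.row]))) (a : Δ.A) :
    ((Δ.teleDiagram T.J T.telMap).pathFunctor (loopRow1 jn)).obj a =
      Δ.κ.obj (Δ.XtoE.obj (Δ.toNexus.obj (τ.φ₁.obj a))) := by
  rw [loopRow1, pathFunctor_comp, Functor.comp_obj]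
  erw [Δ.pathPhiId_obj T.J T.telMap 0 jn a, Functor.congr_obj (hT.telMap_row1 0 (row1_mem_le4 0) jn) a]
  simp only [pathToCore, pathFunctor_cons, pathFunctor_nil]
  change Δ.κ.obj (Δ.NtoE.obj (Δ.lamTimes.obj (Δ.toNexus.obj (τ.φ₁.obj a)))) = _
  rw [← Functor.comp_obj Δ.lamTimes Δ.NtoE, Δ.lamTimes_NtoE]

include K hKc hKj

/-- **`(E1)`**: `φ_An (ζ_□)_a = (η_An)_{φ_An a}` for the core homotopy `ζ_□` of the loop through `□`.
[cite: MochizukiAbsTopIII2015, Corollary 3.6 (ii) p.80] -/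
private theorem phi_map_loopNexus (hT : Δ.IsTelecoreAn τ T) (j : T.J (vx 4 .nexus (by decide)))
    (hG2 : Hc.E (pathBetaNexus j) Path.nil) (hJ : T.Jfam.E (loopNexus j) Path.nil)
    (hB : ∀ (x : Δ.X)
      (e₁ : ((Δ.teleDiagram T.J T.telMap).pathFunctor (pathBetaNexus j)).obj x =
        Δ.φ.obj (Δ.κ.obj (Δ.XtoE.obj x)))
      (e₂ : ((Δ.teleDiagram T.J T.telMap).pathFunctor
        (Path.nil : Path (tvNexus T.J) (tvNexus T.J))).obj x = x),
      (Hc.η hG2).app x = eqToHom e₁ ≫ Δ.η.hom.app x ≫ eqToHom e₂.symm)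
    (a : Δ.A) :
    Δ.φ.map ((T.Jfam.η hJ).app a) ≍ Δ.η.hom.app (Δ.φ.obj a) := by
  obtain ⟨k₁, e₁⟩ := hKc (Hc.isSaturated.precomp (Hc.isSaturated.postcomp hG2 Path.nil) (pathPhiNexus j))
  obtain ⟨k₂, e₂⟩ := hKj (T.Jfam.isSaturated.precomp (T.Jfam.isSaturated.postcomp hJ (pathPhiNexus j))
    Path.nil)
  have key := e₁.trans e₂.symm
  rw [Hc.η_whisker hG2 (pathPhiNexus j) Path.nil,
    T.Jfam.η_whisker hJ Path.nil (pathPhiNexus j)] at key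
  have keya := NatTrans.congr_app key a
  simp only [NatTrans.comp_app, eqToHom_app, Functor.whiskerLeft_app, Functor.whiskerRight_app] at keya
  -- the two evaluations, heterogeneously
  have W : ((Δ.teleDiagram T.J T.telMap).pathFunctor (Path.nil : Path (tvNexus T.J) (tvNexus T.J))).map
      ((Hc.η hG2).app (((Δ.teleDiagram T.J T.telMap).pathFunctor (pathPhiNexus j)).obj a)) ≍
      ((Δ.teleDiagram T.J T.telMap).pathFunctor (pathPhiNexus j)).map ((T.Jfam.η hJ).app
        (((Δ.teleDiagram T.J T.telMap).pathFunctor (Path.nil : Path (tvObs T.J) (tvObs T.J))).obj a)) :=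
    heq_of_conj_eq_conj rfl keya
  -- bookkeeping of the path functors
  have hφN : (Δ.teleDiagram T.J T.telMap).pathFunctor (pathPhiNexus j) = 𝟭 _ ⋙ Δ.φ := by
    rw [pathPhiNexus, pathFunctor_cons, pathFunctor_nil]
    exact congrArg (𝟭 _ ⋙ ·) (hT.telMap_nexus nexus_mem_le4 j)
  have hnilA : (Δ.teleDiagram T.J T.telMap).pathFunctor (Path.nil : Path (tvObs T.J) (tvObs T.J)) = 𝟭 _ :=
    pathFunctor_nil _ _
  have hnilX : (Δ.teleDiagram T.J T.telMap).pathFunctor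
      (Path.nil : Path (tvNexus T.J) (tvNexus T.J)) = 𝟭 _ := pathFunctor_nil _ _
  have hxa : ((Δ.teleDiagram T.J T.telMap).pathFunctor (pathPhiNexus j)).obj a = Δ.φ.obj a :=
    (Δ.pathPhiNexus_obj T.J T.telMap j a).trans (Functor.congr_obj (hT.telMap_nexus nexus_mem_le4 j) a)
  have ha : a = ((Δ.teleDiagram T.J T.telMap).pathFunctor
      (Path.nil : Path (tvObs T.J) (tvObs T.J))).obj a := (Functor.congr_obj hnilA a).symm
  -- left evaluation: `η_An` at `φ_An a`
  have hL : ((Δ.teleDiagram T.J T.telMap).pathFunctor (Path.nil : Path (tvNexus T.J) (tvNexus T.J))).map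
      ((Hc.η hG2).app (((Δ.teleDiagram T.J T.telMap).pathFunctor (pathPhiNexus j)).obj a)) ≍
      Δ.η.hom.app (Δ.φ.obj a) := by
    rw [hB _ ((Δ.pathBetaNexus_obj T.J T.telMap j _).trans
      (Functor.congr_obj (hT.telMap_nexus nexus_mem_le4 j) _)) (Δ.pathNil_obj T.J T.telMap _)]
    exact (map_conj_heq_of_eq_id hnilX _ _ _).trans (app_heq Δ.η.hom hxa)
  -- right evaluation: `φ_An (ζ_□)_a`
  have hR : Δ.φ.map ((T.Jfam.η hJ).app a) ≍
      ((Δ.teleDiagram T.J T.telMap).pathFunctor (pathPhiNexus j)).map ((T.Jfam.η hJ).app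
        (((Δ.teleDiagram T.J T.telMap).pathFunctor (Path.nil : Path (tvObs T.J) (tvObs T.J))).obj a)) :=
    map_heq' (F := 𝟭 _ ⋙ Δ.φ) hφN.symm (by rw [← ha]) (by rw [← ha]) (app_heq (T.Jfam.η hJ) ha)
  exact hR.trans (W.symm.trans hL)

/-- **`(E2)`**: `φ_⋎ (ζ_⋎)_a = (η_⋎)_{φ_⋎ a}` for the core homotopy `ζ_⋎` of the loop through `⋎`.
[cite: MochizukiAbsTopIII2015, Corollary 3.6 (ii) p.80] -/
private theorem phi1_map_loopRow1 (hT : Δ.IsTelecoreAn τ T)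
    (jn : T.J (vx 4 (.row1 0) (by simp [LFVertex.row])))
    (hG3 : Hc.E (pathBetaRow1 0 jn) Path.nil) (hJ1 : T.Jfam.E (loopRow1 jn) Path.nil)
    (hC : ∀ (x : Δ.X₁)
      (e₁ : ((Δ.teleDiagram T.J T.telMap).pathFunctor (pathBetaRow1 0 jn)).obj x =
        τ.φ₁.obj (Δ.κ.obj (Δ.XtoE.obj (Δ.toNexus.obj x))))
      (e₂ : ((Δ.teleDiagram T.J T.telMap).pathFunctor
        (Path.nil : Path (tvRow1 T.J 0) (tvRow1 T.J 0))).obj x = x),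
      (Hc.η hG3).app x = eqToHom e₁ ≫ τ.η₁.hom.app x ≫ eqToHom e₂.symm)
    (a : Δ.A) :
    τ.φ₁.map ((T.Jfam.η hJ1).app a) ≍ τ.η₁.hom.app (τ.φ₁.obj a) := by
  obtain ⟨k₁, e₁⟩ := hKc (Hc.isSaturated.precomp (Hc.isSaturated.postcomp hG3 Path.nil) (edgeRow1 jn))
  obtain ⟨k₂, e₂⟩ := hKj (T.Jfam.isSaturated.precomp (T.Jfam.isSaturated.postcomp hJ1 (edgeRow1 jn))
    Path.nil)
  have key := e₁.trans e₂.symm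
  rw [Hc.η_whisker hG3 (edgeRow1 jn) Path.nil,
    T.Jfam.η_whisker hJ1 Path.nil (edgeRow1 jn)] at key
  have keya := NatTrans.congr_app key a
  simp only [NatTrans.comp_app, eqToHom_app, Functor.whiskerLeft_app, Functor.whiskerRight_app] at keya
  have W : ((Δ.teleDiagram T.J T.telMap).pathFunctor (Path.nil : Path (tvRow1 T.J 0) (tvRow1 T.J 0))).map
      ((Hc.η hG3).app (((Δ.teleDiagram T.J T.telMap).pathFunctor (edgeRow1 jn)).obj a)) ≍
      ((Δ.teleDiagram T.J T.telMap).pathFunctor (edgeRow1 jn)).map ((T.Jfam.η hJ1).app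
        (((Δ.teleDiagram T.J T.telMap).pathFunctor (Path.nil : Path (tvObs T.J) (tvObs T.J))).obj a)) :=
    heq_of_conj_eq_conj rfl keya
  have hφ1 : (Δ.teleDiagram T.J T.telMap).pathFunctor (edgeRow1 jn) = 𝟭 _ ⋙ τ.φ₁ := by
    rw [edgeRow1, pathFunctor_cons, pathFunctor_nil]
    exact congrArg (𝟭 _ ⋙ ·) (hT.telMap_row1 0 (row1_mem_le4 0) jn)
  have hnilA : (Δ.teleDiagram T.J T.telMap).pathFunctor (Path.nil : Path (tvObs T.J) (tvObs T.J)) = 𝟭 _ :=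
    pathFunctor_nil _ _
  have hnil1 : (Δ.teleDiagram T.J T.telMap).pathFunctor
      (Path.nil : Path (tvRow1 T.J 0) (tvRow1 T.J 0)) = 𝟭 _ := pathFunctor_nil _ _
  have hxa : ((Δ.teleDiagram T.J T.telMap).pathFunctor (edgeRow1 jn)).obj a = τ.φ₁.obj a :=
    Functor.congr_obj hφ1 a
  have ha : a = ((Δ.teleDiagram T.J T.telMap).pathFunctor
      (Path.nil : Path (tvObs T.J) (tvObs T.J))).obj a := (Functor.congr_obj hnilA a).symm
  have hL : ((Δ.teleDiagram T.J T.telMap).pathFunctor (Path.nil : Path (tvRow1 T.J 0) (tvRow1 T.J 0))).map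
      ((Hc.η hG3).app (((Δ.teleDiagram T.J T.telMap).pathFunctor (edgeRow1 jn)).obj a)) ≍
      τ.η₁.hom.app (τ.φ₁.obj a) := by
    rw [hC _ ((Δ.pathBetaRow1_obj T.J T.telMap 0 jn _).trans
      (Functor.congr_obj (hT.telMap_row1 0 (row1_mem_le4 0) jn) _)) (Δ.pathNil_obj T.J T.telMap _)]
    exact (map_conj_heq_of_eq_id hnil1 _ _ _).trans (app_heq τ.η₁.hom hxa)
  have hR : τ.φ₁.map ((T.Jfam.η hJ1).app a) ≍
      ((Δ.teleDiagram T.J T.telMap).pathFunctor (edgeRow1 jn)).map ((T.Jfam.η hJ1).app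
        (((Δ.teleDiagram T.J T.telMap).pathFunctor (Path.nil : Path (tvObs T.J) (tvObs T.J))).obj a)) :=
    map_heq' (F := 𝟭 _ ⋙ τ.φ₁) hφ1.symm (by rw [← ha]) (by rw [← ha]) (app_heq (T.Jfam.η hJ1) ha)
  exact hR.trans (W.symm.trans hL)

/-- **`(E3)`**: the core homotopy between the two loops is `π'_An(e⁻¹)`, `π'_An = κ_An ∘ (𝒩 → ℰ) ∘ λ^×`.
[cite: MochizukiAbsTopIII2015, Corollary 3.6 (ii) p.80] -/
private theorem loops_eta (hT : Δ.IsTelecoreAn τ T) (j : T.J (vx 4 .nexus (by decide)))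
    (jn : T.J (vx 4 (.row1 0) (by simp [LFVertex.row])))
    (hG1 : Hc.E (pathPhiNexus j) (pathPhiId 0 jn)) (hJNR : T.Jfam.E (loopNexus j) (loopRow1 jn))
    (hA : ∀ (a : Δ.A)
      (e₁ : ((Δ.teleDiagram T.J T.telMap).pathFunctor (pathPhiNexus j)).obj a = Δ.φ.obj a)
      (e₂ : ((Δ.teleDiagram T.J T.telMap).pathFunctor (pathPhiId 0 jn)).obj a =
        Δ.toNexus.obj (τ.φ₁.obj a)),
      (Hc.η hG1).app a = eqToHom e₁ ≫ τ.e.inv.app a ≫ eqToHom e₂.symm)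
    (a : Δ.A) :
    (T.Jfam.η hJNR).app a ≍ (Δ.lamTimes ⋙ Δ.NtoE ⋙ Δ.κ).map (τ.e.inv.app a) := by
  obtain ⟨k₁, e₁⟩ := hKc (Hc.isSaturated.precomp (Hc.isSaturated.postcomp hG1 (pathToCore T.J)) Path.nil)
  obtain ⟨k₂, e₂⟩ := hKj hJNR
  have key := e₁.trans e₂.symm
  rw [Hc.η_whisker hG1 Path.nil (pathToCore T.J)] at key
  have keya := NatTrans.congr_app key a
  simp only [NatTrans.comp_app, eqToHom_app, Functor.whiskerLeft_app, Functor.whiskerRight_app] at keya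
  have W : (T.Jfam.η hJNR).app a ≍ ((Δ.teleDiagram T.J T.telMap).pathFunctor (pathToCore T.J)).map
      ((Hc.η hG1).app (((Δ.teleDiagram T.J T.telMap).pathFunctor
        (Path.nil : Path (tvObs T.J) (tvObs T.J))).obj a)) :=
    (conj_eqToHom_iff_heq' _ _ _ _).1 keya.symm
  have hS : (Δ.teleDiagram T.J T.telMap).pathFunctor (pathToCore T.J) =
      ((𝟭 _ ⋙ Δ.lamTimes) ⋙ Δ.NtoE) ⋙ Δ.κ := by
    rw [pathToCore, pathFunctor_cons, pathFunctor_cons, pathFunctor_cons, pathFunctor_nil]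
    rfl
  have hnilA : (Δ.teleDiagram T.J T.telMap).pathFunctor (Path.nil : Path (tvObs T.J) (tvObs T.J)) = 𝟭 _ :=
    pathFunctor_nil _ _
  have ha : ((Δ.teleDiagram T.J T.telMap).pathFunctor
      (Path.nil : Path (tvObs T.J) (tvObs T.J))).obj a = a := Functor.congr_obj hnilA a
  refine W.trans ?_
  rw [hA _ ((Δ.pathPhiNexus_obj T.J T.telMap j _).trans
      (Functor.congr_obj (hT.telMap_nexus nexus_mem_le4 j) _))
    ((Δ.pathPhiId_obj T.J T.telMap 0 jn _).trans
      (congrArg Δ.toNexus.obj (Functor.congr_obj (hT.telMap_row1 0 (row1_mem_le4 0) jn) _)))]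
  refine (map_conj_heq _ _ _ _).trans ?_
  exact map_heq' (G := Δ.lamTimes ⋙ Δ.NtoE ⋙ Δ.κ) hS (by rw [ha]) (by rw [ha]) (app_heq τ.e.inv ha)

end Witness

/-! ### The computation in `𝒳` -/

/-- The final diagram chase, with all objects generalised: from the four evaluations of the common
family and the composition law of the telecore family, `id_⋎ (η_⋎)_{φ_⋎ a} = e ∘ η_An`. [folklore] -/
private theorem coherence_calc {A X₁ X : Type u} [Category.{u} A] [Category.{u} X₁] [Category.{u} X]
    {φ : A ⥤ X} {φ₁ : A ⥤ X₁} {ν : X₁ ⥤ X} {π : X ⥤ A} (e : φ₁ ⋙ ν ≅ φ) (η : π ⋙ φ ≅ 𝟭 X)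
    (η₁ : (ν ⋙ π) ⋙ φ₁ ≅ 𝟭 X₁) (a : A) {C DN D1 : A} (hC : a = C) (hDN : DN = π.obj (φ.obj a))
    (hD1 : D1 = π.obj (ν.obj (φ₁.obj a))) (ζN : DN ⟶ C) (ζ1 : D1 ⟶ C) (x : D1 ⟶ DN) (y : DN ⟶ D1)
    (J1 : ζ1 = x ≫ ζN) (J2 : x ≫ y = 𝟙 _) (E1 : φ.map ζN ≍ η.hom.app (φ.obj a))
    (E2 : φ₁.map ζ1 ≍ η₁.hom.app (φ₁.obj a)) (E3 : y ≍ π.map (e.inv.app a)) :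
    ν.map (η₁.hom.app (φ₁.obj a)) =
      e.hom.app (π.obj (ν.obj (φ₁.obj a))) ≫ η.hom.app (ν.obj (φ₁.obj a)) := by
  subst hC hDN hD1
  have E3' : y = π.map (e.inv.app a) := eq_of_heq E3
  have E2' : η₁.hom.app (φ₁.obj a) = φ₁.map ζ1 := (eq_of_heq E2).symm
  have E1' : φ.map ζN = η.hom.app (φ.obj a) := eq_of_heq E1
  -- `x = π_An(e_a)`: the inverse of `y = π_An(e_a⁻¹)`
  have h2 : y ≫ π.map (e.hom.app a) = 𝟙 _ := by
    rw [E3']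
    erw [← π.map_comp, Iso.inv_hom_id_app, π.map_id]
  have hx : x = π.map (e.hom.app a) := by
    have h1 : x ≫ (y ≫ π.map (e.hom.app a)) = π.map (e.hom.app a) := by
      erw [← Category.assoc, J2]
      exact Category.id_comp _
    rw [h2] at h1
    erw [Category.comp_id] at h1
    exact h1
  -- naturality of `e` and of `η_An`
  have n1 : ν.map (φ₁.map ζ1) = e.hom.app _ ≫ φ.map ζ1 ≫ e.inv.app _ :=
    (NatIso.naturality_2 e ζ1).symm
  have n2 : φ.map (π.map (e.hom.app a)) ≫ η.hom.app (φ.obj a) = η.hom.app _ ≫ e.hom.app a := by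
    have := η.hom.naturality (e.hom.app a)
    erw [Functor.id_map] at this
    exact this
  rw [E2']
  refine n1.trans ?_
  rw [J1, hx, Functor.map_comp, E1']
  erw [n2, Category.assoc, Iso.hom_inv_id_app, Category.comp_id]
  rfl

/-! ### Necessity of the coherence hypothesis -/

/-- **The coherence of `η_⋎` with `η_An` is NECESSARY** for Cor. 3.6 (ii) as typed: if `TelecoreStmt τ`
holds — there are a core structure on `(𝒟_{≤5}, Anab)`, a telecore of the printed shape over it and
a compatible contact structure generated by the printed pairs with the printed homotopies
`η_{□⋎} = e⁻¹`, `η_□ = η_An`, `η_⋎ = η₁` — then on the essential image of `φ_⋎` the datum `η₁` IS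
"the isomorphism arising from `η_An`": `id_⋎ (η₁)_{φ_⋎ a} = e_{π_An(id_⋎ φ_⋎ a)} ∘ (η_An)_{id_⋎ φ_⋎ a}`
(the hypothesis `hτ` of `telecoreStmt_of_coherent` at `x = φ_⋎ a`).
[cite: MochizukiAbsTopIII2015, Corollary 3.6 (ii) p.80] -/
theorem coherent_of_telecoreStmt (h : Δ.TelecoreStmt τ) (a : Δ.A) :
    Δ.toNexus.map (τ.η₁.hom.app (τ.φ₁.obj a)) =
      τ.e.hom.app (Δ.κ.obj (Δ.XtoE.obj (Δ.toNexus.obj (τ.φ₁.obj a)))) ≫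
        Δ.η.hom.app (Δ.toNexus.obj (τ.φ₁.obj a)) := by
  obtain ⟨H, hH, hc, T, hT, Hc, ⟨K, hK⟩, hgen, hA, hB, hC⟩ := h
  obtain ⟨hsubC, hηC⟩ := hK true
  obtain ⟨hsubJ, hηJ⟩ := hK false
  have hKc : ∀ ⦃a b : (teleShape T.J).Vertex⦄ ⦃p q : Path a b⦄ (h : Hc.E p q),
      ∃ h' : K.E p q, Hc.η h = K.η h' := fun _ _ _ _ h => ⟨hsubC h, hηC h⟩
  have hKj : ∀ ⦃a b : (teleShape T.J).Vertex⦄ ⦃p q : Path a b⦄ (h : T.Jfam.E p q),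
      ∃ h' : K.E p q, T.Jfam.η h = K.η h' := fun _ _ _ _ h => ⟨hsubJ h, hηJ h⟩
  -- telecore edges at `□` and `⋎ = 0`
  obtain ⟨j⟩ := (hT.edges_iff (vx 4 .nexus (by decide))).mpr (by decide)
  obtain ⟨jn⟩ := (hT.edges_iff (vx 4 (.row1 0) (by simp [LFVertex.row]))).mpr
    (by simp [vx, LFVertex.row])
  -- the printed generators lie in the contact structure; the loops lie in the telecore family
  have hG1 : Hc.E (pathPhiNexus j) (pathPhiId 0 jn) :=
    (hgen _ _).2 (Saturation.base (ContactGen.etaSq 0 j jn))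
  have hG2 : Hc.E (pathBetaNexus j) Path.nil := (hgen _ _).2 (Saturation.base (ContactGen.etaNexus j))
  have hG3 : Hc.E (pathBetaRow1 0 jn) Path.nil :=
    (hgen _ _).2 (Saturation.base (ContactGen.etaRow1 0 jn))
  have hJ : T.Jfam.E (loopNexus j) Path.nil :=
    (T.boundary_iff _ _).2 ⟨loopNexus j, Path.nil, Path.nil, rfl, rfl⟩
  have hJ1 : T.Jfam.E (loopRow1 jn) Path.nil :=
    (T.boundary_iff _ _).2 ⟨loopRow1 jn, Path.nil, Path.nil, rfl, rfl⟩
  have hJ1N : T.Jfam.E (loopRow1 jn) (loopNexus j) :=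
    (T.boundary_iff _ _).2 ⟨loopRow1 jn, loopNexus j, Path.nil, rfl, rfl⟩
  have hJNR : T.Jfam.E (loopNexus j) (loopRow1 jn) :=
    (T.boundary_iff _ _).2 ⟨loopNexus j, loopRow1 jn, Path.nil, rfl, rfl⟩
  -- the four evaluations and the composition law of `𝒥`
  have E1 := Δ.phi_map_loopNexus τ T Hc K hKc hKj hT j hG2 hJ (hB j hG2) a
  have E2 := Δ.phi1_map_loopRow1 τ T Hc K hKc hKj hT jn hG3 hJ1 (hC 0 jn hG3) a
  have E3 := Δ.loops_eta τ T Hc K hKc hKj hT j jn hG1 hJNR (hA 0 j jn hG1) a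
  have hπ : Δ.lamTimes ⋙ Δ.NtoE ⋙ Δ.κ = Δ.XtoE ⋙ Δ.κ := by rw [← Functor.assoc, Δ.lamTimes_NtoE]
  have J1 : (T.Jfam.η hJ1).app a = (T.Jfam.η hJ1N).app a ≫ (T.Jfam.η hJ).app a :=
    NatTrans.congr_app (T.Jfam.η_trans hJ1N hJ) a
  have J2 : (T.Jfam.η hJ1N).app a ≫ (T.Jfam.η hJNR).app a = 𝟙 _ :=
    (NatTrans.congr_app (T.Jfam.η_trans hJ1N hJNR) a).symm.trans
      (NatTrans.congr_app (T.Jfam.η_refl (T.Jfam.isSaturated.trans hJ1N hJNR)) a)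
  exact coherence_calc τ.e Δ.η τ.η₁ a (Δ.pathNil_obj T.J T.telMap (a := tvObs T.J) a).symm
    (Δ.loopNexus_obj τ T hT j a)
    (Δ.loopRow1_obj τ T hT jn a) _ _ _ _ J1 J2 E1 E2
    (E3.trans (map_heq' hπ rfl rfl HEq.rfl))


end LogFrobeniusData

end Literature.AnabelianGeometry.AbsoluteAnabelian
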